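import Summits.QuantumFields.BalabanUV.Beta.GAN24.WilsonGradedBlockSums

/-!
# `BalabanUV.Beta.GAN24.WilsonFaceGradedIdentity` — binder row G-an2-4 ∕ (CONV-C), W-slot CT-W, route «WC-TL», table fact «3F-REC» ∕ «S3C-REC» (PRICING Q-S3C):
# **(W-FACE) HOLDS — THE OFFSET-GRADED FACE SUMS OF an3's ANTISYMMETRISED CUBIC WILSON TABLE VANISH, EVERY `d`, EVERY `(γ, α, β)`**:
# `Σ_{x ∈ box1} Σ_{z ∈ box1} [ (α = γ → x_α = 0) ∧ (β = γ → z_β = 0) ∧ (α = β ≠ γ → x_α = z_β) ] · wilsonA d γ 0 x z (inl α) (inl β) = 0`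

NOT IN PRINT; OUR BOOKKEEPING ([folklore] finite stencil algebra over an3's `StepJetData.wEntry ∕ wilsonA` and `PlaquetteStencilData` tables read through
leaf-15's register `WilsonVertexSumZero` (`wEntry_eq_sum`, `suppW`, `sum_wc_eq_zero`) and part 1 `WilsonGradedBlockSums` (`keyL`, `keyR`) BY NAME; G-an2-4
formalisation swarm, leaf prover `b2b-balaban-gan24-formalise-leaf-04`, gen 63; part 2 of 3).  HONEST FRAMING (cell contract, verbatim): «discharging `BetaPertH`
makes Bałaban's UV stability UNCONDITIONAL — a real constructive-QFT result; it is NOT the continuum limit and NOT the Clay problem.»  HONEST DEPENDENCY (verbatim):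
«continuum YM on T⁴ ⇐ BetaPertH ∧ nine spine estimates (0/9 proved); BetaPertH ⇐ (D1) ∧ (D4) ∧ CAP+tail; G-an2-4 gates asym, D1 and NE2/3/4.»

THE STATEMENT (`sum_box1_graded_wilsonA_eq_zero`) is LITERALLY the hypothesis `hG` of `WilsonThreeFaceGraded.threeFace_wilsonA_of_graded` (gen 62, file H),
of `ThreeFaceRecOfLetters.hasSum_unitS_SpureRecAt_of_gradedWilson` (Fl v3) and of `ThreeFaceRecLiteral.exists_allScalesSeq_JsRowD1Pin_of_gradedWilson_C_QD`
(Literal) — the ONE finite table identity the «S3C-REC» chain of gen 62 was closed modulo; the successor file `GAN24/ThreeFaceRecClosed` discharges it there.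

MECHANISM (generic `d`).  §1: against ANY pair weight `F x z` over any finite `S ⊇ suppW κ′ u` the double sum of the raw table is the stencil sum
`Σ_i F (u + wα i) (u + wβ i) · wc κ′ i α β` (`sum_weighted_wEntry` — leaf-15's `wEntry_sum_zero_of_supp` with weights; `sum_weighted_wilsonA`), so the graded box
sum of the antisymmetrised table at the slot `0` is `½ Σ_i [c ((wα i)_α, (wβ i)_β)]·wc γ i α β − ½ Σ_i [c ((wβ i)_α, (wα i)_β)]·wc γ i β α` (`sum_box1_graded_wilsonA`,
support `suppW_zero_subset_box1`).  §2: the case assembly — `α = β`: the grading is symmetric under the leg swap and the table is antisymmetrised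
(`if_congr and_comm ∕ eq_comm`); `α = γ ≠ β`: part 1's (KL) on the first stencil sum and (KR) on the second, weight `φ = 𝟙_{0}`; `β = γ ≠ α`: (KR) ∕ (KL);
pairwise distinct: no grading, leaf-15's `sum_wc_eq_zero` twice.

READING (context only, asserted nowhere): (W-face) is the finite shadow of the Ward identity «the cubic Wilson vertex vanishes on three pure-gauge step fields»
(index-slot law `ContactOneGaugeCellAlgebra.tsum_dz_mul_wilsonA_idx` + Maxwell exactness); the generalised graded sums with arbitrary pins also vanish in exact
arithmetic (`d+1 = 2,3,4` on leaf-02 g11's tables, `d+1 = 2,…,6` on this lineage's stencil mirror; `g63/num/`), as that reading predicts; the typed route is the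
finite one above.

WHAT ([folklore]; 0 `def`, 0 cited facts, 0 `def … : Prop`, 0 sorry; generic `d`; imports part 1 ONLY): §1 `sum_weighted_wEntry`, `sum_weighted_wilsonA`,
`suppW_zero_subset_box1`, `sum_box1_graded_wilsonA`; §2 **`sum_box1_graded_wilsonA_eq_zero`**.  Asserts NO value of Bałaban's tables beyond these finite
identities of an3's defined stencil; discharges NOTHING of (C)sym ∕ (Q-D) ∕ (Q-D-rate) ∕ «T2Shape» ∕ «T2Drift» ∕ (hW, hWall) ∕ D1; NOT «D1 closed»; NEVER «G-an2-4
closed» as (CONV-C); NOT D1, NOT `BetaPertH`, NOT continuum, NOT Clay.  2026-08-22; no existing file touched.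
-/

noncomputable section

open Finset
open scoped BigOperators
open Literature.MathematicalPhysics.QuantumFieldTheory.Balaban1983to89
open Literature.MathematicalPhysics.QuantumFieldTheory.Balaban1983to89.Beta
open PlaquetteStencilData (WilsonIdx wα wβ isOffset_wα isOffset_wβ)
open StepJetData (wEntry wilsonA)
open BalabanStepJets (box1)
open Summit.QuantumFields.BalabanUV.Beta.GAN24.WilsonVertexSumZero (uv wc wEntry_eq_sum sum_wc_eq_zero suppW row_mem_suppW col_mem_suppW
  mem_box1_of_isOffset)
open Summit.QuantumFields.BalabanUV.Beta.GAN24.WilsonGradedBlockSums (keyL keyR)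

namespace Summit.QuantumFields.BalabanUV.Beta.GAN24.WilsonFaceGradedIdentity

variable {d : ℕ}

/-! ## §1 Weighted double sums of the table are finite stencil sums -/

/-- [folklore] **WEIGHTED DOUBLE SUM OF THE RAW TABLE**: for any pair weight `F` and any finite `S ⊇ suppW κ′ u`,
`Σ_{x,z ∈ S} F x z · wEntry d κ′ u x z α β = Σ_i F (u + wα i) (u + wβ i) · wc κ′ i α β` (leaf-15's `wEntry_sum_zero_of_supp`, with weights). -/
theorem sum_weighted_wEntry (κ' : Fin (d + 1)) (u : Fin (d + 1) → ℤ) (α β : Fin (d + 1)) (S : Finset (Fin (d + 1) → ℤ))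
    (hS : suppW κ' u ⊆ S) (F : (Fin (d + 1) → ℤ) → (Fin (d + 1) → ℤ) → ℝ) :
    ∑ x ∈ S, ∑ z ∈ S, F x z * wEntry d κ' u x z α β = ∑ i, F (u + wα uv κ' i) (u + wβ uv κ' i) * wc κ' i α β := by
  have h1 : ∀ x z, F x z * wEntry d κ' u x z α β =
      ∑ i, if x = u + wα uv κ' i ∧ z = u + wβ uv κ' i then F x z * wc κ' i α β else 0 := by
    intro x z
    rw [wEntry_eq_sum, Finset.mul_sum]
    exact Finset.sum_congr rfl fun i _ => by rw [mul_ite, mul_zero]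
  simp_rw [h1]
  have h2 : ∀ x ∈ S, ∑ z ∈ S, ∑ i, (if x = u + wα uv κ' i ∧ z = u + wβ uv κ' i then F x z * wc κ' i α β else 0) =
      ∑ i, ∑ z ∈ S, (if x = u + wα uv κ' i ∧ z = u + wβ uv κ' i then F x z * wc κ' i α β else 0) :=
    fun x _ => Finset.sum_comm
  rw [Finset.sum_congr rfl h2, Finset.sum_comm]
  refine Finset.sum_congr rfl fun i _ => ?_
  rw [Finset.sum_eq_single_of_mem (u + wα uv κ' i) (hS (row_mem_suppW κ' u i))]
  · rw [Finset.sum_eq_single_of_mem (u + wβ uv κ' i) (hS (col_mem_suppW κ' u i))]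
    · rw [if_pos ⟨rfl, rfl⟩]
    · intro z _ hz
      exact if_neg fun h => hz h.2
  · intro x _ hx
    exact Finset.sum_eq_zero fun z _ => if_neg fun h => hx h.1

/-- [folklore] **WEIGHTED DOUBLE SUM OF THE ANTISYMMETRISED TABLE**:
`Σ_{x,z ∈ S} F x z · wilsonA d κ′ u x z (inl α) (inl β) = ½ Σ_i F (u + wα i) (u + wβ i) · wc κ′ i α β − ½ Σ_i F (u + wβ i) (u + wα i) · wc κ′ i β α`. -/
theorem sum_weighted_wilsonA (κ' : Fin (d + 1)) (u : Fin (d + 1) → ℤ) (α β : Fin (d + 1)) (S : Finset (Fin (d + 1) → ℤ))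
    (hS : suppW κ' u ⊆ S) (F : (Fin (d + 1) → ℤ) → (Fin (d + 1) → ℤ) → ℝ) :
    ∑ x ∈ S, ∑ z ∈ S, F x z * wilsonA d κ' u x z (Sum.inl α) (Sum.inl β) =
      1 / 2 * ∑ i, F (u + wα uv κ' i) (u + wβ uv κ' i) * wc κ' i α β -
        1 / 2 * ∑ i, F (u + wβ uv κ' i) (u + wα uv κ' i) * wc κ' i β α := by
  have h1 : ∀ x z, F x z * wilsonA d κ' u x z (Sum.inl α) (Sum.inl β) =
      1 / 2 * (F x z * wEntry d κ' u x z α β) - 1 / 2 * (F x z * wEntry d κ' u z x β α) := fun x z => by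
    show F x z * (1 / 2 * (wEntry d κ' u x z α β - wEntry d κ' u z x β α)) = _
    ring
  simp_rw [h1, Finset.sum_sub_distrib, ← Finset.mul_sum]
  have hA := sum_weighted_wEntry κ' u α β S hS F
  have hB : ∑ x ∈ S, ∑ z ∈ S, F x z * wEntry d κ' u z x β α = ∑ i, F (u + wβ uv κ' i) (u + wα uv κ' i) * wc κ' i β α := by
    rw [Finset.sum_comm]
    exact sum_weighted_wEntry κ' u β α S hS (fun z x => F x z)
  rw [hA, hB]

/-- [folklore] At the slot `u = 0` the support lies in the box `{−1,0,1}^{d+1}` itself. -/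
theorem suppW_zero_subset_box1 (κ' : Fin (d + 1)) : suppW κ' (0 : Fin (d + 1) → ℤ) ⊆ box1 (d + 1) := by
  intro x hx
  rcases Finset.mem_union.1 hx with h | h
  · obtain ⟨i, -, rfl⟩ := Finset.mem_image.1 h
    rw [zero_add]
    exact mem_box1_of_isOffset (isOffset_wα uv κ' i)
  · obtain ⟨i, -, rfl⟩ := Finset.mem_image.1 h
    rw [zero_add]
    exact mem_box1_of_isOffset (isOffset_wβ uv κ' i)

/-- [folklore] **THE GRADED BOX SUM AT SLOT `0` IS A GRADED STENCIL SUM**: for any grading `c` of the pair of leg coordinates `(x_α, z_β)`,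
`Σ_{x,z ∈ box1} [c (x α) (z β)]·wilsonA d γ 0 x z (inl α) (inl β) = ½ Σ_i [c ((wα i) α) ((wβ i) β)]·wc γ i α β − ½ Σ_i [c ((wβ i) α) ((wα i) β)]·wc γ i β α`. -/
theorem sum_box1_graded_wilsonA (γ α β : Fin (d + 1)) (c : ℤ → ℤ → Prop) [DecidableRel c] :
    ∑ x ∈ box1 (d + 1), ∑ z ∈ box1 (d + 1), (if c (x α) (z β) then wilsonA d γ 0 x z (Sum.inl α) (Sum.inl β) else 0) =
      1 / 2 * ∑ i, (if c (wα uv γ i α) (wβ uv γ i β) then wc γ i α β else 0) -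
        1 / 2 * ∑ i, (if c (wβ uv γ i α) (wα uv γ i β) then wc γ i β α else 0) := by
  have h := sum_weighted_wilsonA γ 0 α β (box1 (d + 1)) (suppW_zero_subset_box1 γ)
    (fun x z => if c (x α) (z β) then (1 : ℝ) else 0)
  simp only [zero_add, boole_mul] at h
  exact h

/-! ## §2 (W-FACE): the offset-graded face sums of the antisymmetrised cubic Wilson table vanish -/

section Face

/-- [folklore] **(W-FACE) — THE OFFSET-GRADED FACE SUMS OF THE ANTISYMMETRISED CUBIC WILSON TABLE VANISH**, every `d`, every
`(γ, α, β)`: `Σ_{x ∈ box1} Σ_{z ∈ box1} [ (α = γ → x_α = 0) ∧ (β = γ → z_β = 0) ∧ (α = β ≠ γ → x_α = z_β) ] · wilsonA d γ 0 x z (inl α) (inl β) = 0`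
— LITERALLY the hypothesis `hG` of `WilsonThreeFaceGraded.threeFace_wilsonA_of_graded`, `ThreeFaceRecOfLetters.hasSum_unitS_SpureRecAt_of_gradedWilson`
and `ThreeFaceRecLiteral.exists_allScalesSeq_JsRowD1Pin_of_gradedWilson_C_QD`.  CASES: `α = β` — the grading is symmetric under the leg swap and the table
is antisymmetrised; `α = γ ≠ β` ∕ `β = γ ≠ α` — (KL) and (KR) with the indicator weight of the grade `0`; pairwise distinct — no grading, leaf-15's
`sum_wc_eq_zero` twice. -/
theorem sum_box1_graded_wilsonA_eq_zero (γ α β : Fin (d + 1)) :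
    ∑ x ∈ box1 (d + 1), ∑ z ∈ box1 (d + 1),
      (if ((α = γ → x α = 0) ∧ (β = γ → z β = 0) ∧ (α = β → α ≠ γ → x α = z β)) then
        wilsonA d γ 0 x z (Sum.inl α) (Sum.inl β) else 0) = 0 := by
  have h := sum_weighted_wilsonA γ 0 α β (box1 (d + 1)) (suppW_zero_subset_box1 γ)
    (fun x z => if ((α = γ → x α = 0) ∧ (β = γ → z β = 0) ∧ (α = β → α ≠ γ → x α = z β)) then (1 : ℝ) else 0)
  simp only [zero_add, boole_mul] at h
  rw [h, sub_eq_zero]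
  by_cases hαβ : α = β
  · -- symmetric grading, antisymmetrised table
    subst hαβ
    congr 1
    refine Finset.sum_congr rfl fun i _ => ?_
    by_cases hαγ : α = γ
    · subst hαγ
      simp only [true_implies, ne_eq, not_true_eq_false, false_implies, implies_true, and_true]
      exact if_congr and_comm rfl rfl
    · simp only [hαγ, false_implies, true_and, ne_eq, not_false_eq_true, true_implies]
      exact if_congr eq_comm rfl rfl
  · by_cases hαγ : α = γ
    · -- (KL) on the first sum, (KR) on the second
      subst hαγ
      have hne : α ≠ β := hαβ
      have hβα : ¬β = α := fun h => hαβ h.symm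
      have h1 := keyL hne (fun a => if a = 0 then (1 : ℝ) else 0)
      have h2 := keyR hne (fun a => if a = 0 then (1 : ℝ) else 0)
      simp only [boole_mul] at h1 h2
      simp only [true_implies, hβα, false_implies, hαβ, and_true, h1, h2]
    · by_cases hβγ : β = γ
      · -- (KR) on the first sum, (KL) on the second
        subst hβγ
        have hne : β ≠ α := fun h => hαβ h.symm
        have h1 := keyR hne (fun a => if a = 0 then (1 : ℝ) else 0)
        have h2 := keyL hne (fun a => if a = 0 then (1 : ℝ) else 0)
        simp only [boole_mul] at h1 h2
        simp only [hαγ, false_implies, true_implies, true_and, and_true, h1, h2]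
      · -- pairwise distinct: no grading
        simp only [hαγ, hβγ, hαβ, false_implies, and_self, if_true, sum_wc_eq_zero]

end Face

end Summit.QuantumFields.BalabanUV.Beta.GAN24.WilsonFaceGradedIdentity

end
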